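import Mathlib.Analysis.Matrix.Spectrum
import Mathlib.Analysis.Matrix.PosDef
import Mathlib.Analysis.SpecialFunctions.Log.NegMulLog
import HarnessLib

/-!
# Von Neumann entropy of a finite-dimensional density matrix

The von Neumann entropy `S(ρ) = −tr(ρ log ρ) = −Σ_x λ_x log λ_x` of a density matrix `ρ` (positive
semidefinite, trace one) on a finite-dimensional Hilbert space, in the eigenvalue form
[cite: NielsenChuang2010, §11.3 eqs. (11.39)–(11.40), p. 510], with the convention `0 log 0 = 0`
(Mathlib's `Real.negMulLog`). We use the natural logarithm; Nielsen–Chuang take `log₂` — every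
inequality of the form `… ≥ 0` / `S(·) ≤ S(·) + S(·)` cited from there is base-independent.

Proved here: the eigenvalue formula as a rewriting lemma, `0 ≤ λ_x ≤ 1` for the eigenvalues of a
density matrix, and non-negativity `0 ≤ S(ρ)` [cite: NielsenChuang2010, Thm 11.8 (1), p. 513].
This file is the common vocabulary for the entropy (weak-monotonicity) constraints of
translation-invariant SDP relaxations [cite: FawziFawziScalet2024Entropy, Lemma 2.1 and Thm 4.1]
used by `Summits/Ventures/CertifiedManyBodySolver` (lever family `ent`); the deep inequalities
(strong subadditivity / weak monotonicity, Lieb–Ruskai 1973; monotonicity of the relative entropy,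
Lindblad 1975) are NOT stated here.
-/

namespace Literature.InformationTheory.Entropy

open Matrix
open scoped ComplexOrder

variable {n : Type*} [Fintype n] [DecidableEq n]

/-- **Von Neumann entropy** `S(ρ) = Σ_x η(λ_x)`, `η(t) = −t log t`, over the eigenvalues `λ_x` of the
Hermitian matrix `ρ` [cite: NielsenChuang2010, §11.3 eq. (11.40)]; the junk value `0` is returned for a
non-Hermitian argument so that `vonNeumannEntropy ρ` needs no proof argument. Natural logarithm. -/
noncomputable def vonNeumannEntropy (ρ : Matrix n n ℂ) : ℝ :=
  if h : ρ.IsHermitian then ∑ i, Real.negMulLog (h.eigenvalues i) else 0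

/-- Unfolding: for a Hermitian `ρ`, `S(ρ) = Σ_i η(λ_i(ρ))` with `η = Real.negMulLog`
[cite: NielsenChuang2010, eq. (11.40)]. -/
theorem vonNeumannEntropy_eq {ρ : Matrix n n ℂ} (hρ : ρ.IsHermitian) :
    vonNeumannEntropy ρ = ∑ i, Real.negMulLog (hρ.eigenvalues i) := by
  rw [vonNeumannEntropy, dif_pos hρ]

/-- The eigenvalues of a trace-one Hermitian matrix sum to `1`: 'From the trace condition we see that
Σ_j λ_j = 1' [cite: NielsenChuang2010, Thm 2.5 (Characterization of density operators) and its proof, p. 101]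
(real form of `Matrix.IsHermitian.trace_eq_sum_eigenvalues`). -/
theorem sum_eigenvalues_eq_one {ρ : Matrix n n ℂ} (hρ : ρ.IsHermitian) (htr : ρ.trace = 1) :
    ∑ i, hρ.eigenvalues i = 1 := by
  have h := congrArg Complex.re hρ.trace_eq_sum_eigenvalues
  rw [htr] at h
  simpa using h.symm

/-- Every eigenvalue of a density matrix is at most `1`: the eigenvalues are 'real, non-negative' and
'Σ_j λ_j = 1' [cite: NielsenChuang2010, Thm 2.5 (Characterization of density operators) and its proof, p. 101],
so each single one is bounded by the sum. -/
theorem eigenvalues_le_one {ρ : Matrix n n ℂ} (hρ : ρ.PosSemidef) (htr : ρ.trace = 1) (i : n) :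
    hρ.1.eigenvalues i ≤ 1 := by
  calc hρ.1.eigenvalues i ≤ ∑ j, hρ.1.eigenvalues j :=
        Finset.single_le_sum (fun j _ => hρ.eigenvalues_nonneg j) (Finset.mem_univ i)
    _ = 1 := sum_eigenvalues_eq_one hρ.1 htr

/-- **Non-negativity of the von Neumann entropy** of a density matrix: `0 ≤ S(ρ)`, because each
eigenvalue lies in `[0,1]` where `η(t) = −t log t ≥ 0` [cite: NielsenChuang2010, Thm 11.8 (1), p. 513]. -/
theorem vonNeumannEntropy_nonneg {ρ : Matrix n n ℂ} (hρ : ρ.PosSemidef) (htr : ρ.trace = 1) :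
    0 ≤ vonNeumannEntropy ρ := by
  rw [vonNeumannEntropy_eq hρ.1]
  exact Finset.sum_nonneg fun i _ =>
    Real.negMulLog_nonneg (hρ.eigenvalues_nonneg i) (eigenvalues_le_one hρ htr i)

end Literature.InformationTheory.Entropy
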